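/-
Origin: expansion seat `planner-pub-hodgecm-pv03-g8-0`, handover #1 2026-08-18T14:01:14Z (md5 b824a381) (`HOME/pub-hodgecm-pv03-g8/lean/Pv03g8/NoEndState3.lean`, md5 b824a381, 283 lines);
landed by the gen-8 packager in gate run 30 as `HodgeCM/Model/ToyG2/NoEndState3.lean` (verbatim).
-/
/-
# `NoEndState3` — no end state over the universe of record: the Hodge–Riemann `(2,0)` print fact N07 fails in
# `toyUniverse₃ d t` (a second, single-block isotropic witness) and in the CM-good universe `toyUniverseCM d t`

Unit `pub-hodgecm-pv03-g8` (DAG-NODE PROVER #03, gen 8).  ONE NEW FILE, ADDITIVE KERNEL LEAF (kind L5, separating-model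
record): nothing in the tree is edited, nothing imports this file.  Imports are TREE module names only.

**Headline of record.**  The statement `¬ (toyUniverse₃ d t).Fact_hodgeRiemann20` is toy-g5's
`HodgeCM.ToyG2.not_toyUniverse₃_hodgeRiemann20` (`HodgeCM/Model/ToyG2/HodgeRiemann3.lean`, CLAIM 2026-08-18T13:50:29Z: a
MIXED-BLOCK witness `E_{q₁,0,ι₁} ∪ E_{q₂,0,ι₁}` over the face field, isotropic by `period_eCls_mixed₃`).  The present file is
IMPORT-INDEPENDENT of it; it gives a DIFFERENT (single-block) witness and then the consequences for the END STATE of the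
`PerL34` headline and for the CM-good universe, which that file does not state.

## What is proved (kernel-checked; axioms ⊆ {propext, Classical.choice, Quot.sound})

`HodgeCM.Universe.Fact_hodgeRiemann20` (`HodgeCM/Automorphic/ThetaFacts.lean`, class **PRINT**; = the binder `h07 :
PerL34.N07_hodgeRiemann20 U` of every end state of record) reads: on a surface, `tr(η ∪ η̄) ≠ 0` for every nonzero
`η ∈ F²H²`.  In the universe of record `HodgeCM.ToyG2.toyUniverse₃ d t` (toy-g2/g3; all 28 model axioms, the open inputs,
`PerL`, `HC_CM` — `toyUniverse₃_profile_all`) it is FALSE, for every `d t`, ALREADY ON A SINGLE LEAF BLOCK: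

* `not_hodgeRiemann20_of_finrank` — for ANY CM field `L` with `4 ≤ [L:ℚ]`, any `ι₁`, hermitian space `V`, level `Γ` and ANY
  ONE block `k`, the Picard modular surface `pms L ι₁ V Γ` of `toyUniverse₃ d t` carries the explicit class
  `η := E_{k,0,τ} ∪ E_{k,0,τ'}` (two single-eigenvector classes of the SAME block and slot with DISTINCT holomorphic indices
  `τ ≠ τ'`, which exist because the CM type `Θ_{k,0}` has `[L:ℚ]/2 ≥ 2` elements — `exists_mem_ne_of_cmType`) with
  `η ∈ F²H²` (`ThetaUiso.eCls_mem_H10₃` + M4 `Fact_cup2_hodge` via `Universe.cup2C_mem_F2`), `η ≠ 0`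
  (`ThetaUiso.cup_eCls_ne_zero₃`) and `tr(η ∪ η̄) = tr(E_{τ} E_{τ'} E_{τ̄} E_{τ̄'}) = 0` (`conj_cup2C`, `conj_eCls`, and the
  SLOT-PATTERN vanishing `ThetaUiso.trC_quadC_eCls_eq_zero₃`: the pattern `(0,0,0,0)` misses slot `1`) — so the failure of
  N07 is not an artefact of several blocks: the trace of the model only sees slot patterns exhausting `{0,1,2,3}`;
* `toyUniverse₃_not_hodgeRiemann20 (d t) : ¬ (toyUniverse₃ d t).Fact_hodgeRiemann20` — the instance `L = ℚ(ζ₇)`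
  (`HodgeCM.cyclo7`, degree 6), Landherr's hermitian space (`StubTree.landherr_exists`), `Level.three`, the constant block
  `qAt` (= toy-g5's headline, second proof; kept so that this file is import-independent);
* hence **no end state over the universe of record**: `toyUniverse₃_no_endStatePrints`, `toyUniverse₃_no_endState`
  (`PerL34.EndStateShadow.EndState T Pc` has the field `h07`), for EVERY theta model `T` over `toyUniverse₃ d t` and every
  choice of pointed cores `Pc`;
* the same three statements in the CM-good universe `toyUniverseCM d t` (pv03-g6 `restrictObj`; all transports are `rfl`):
  `toyUniverseCM_not_hodgeRiemann20`, `toyUniverseCM_no_endStatePrints`, `toyUniverseCM_no_endState`, together with the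
  positive transport `Universe.restrictObj_fact_hodgeRiemann20` (a full sub-universe inherits N07);
* packaging: `exists_model_profile_not_hodgeRiemann20` —
  `∃ U, U.ModelAxioms ∧ U.OpenInputs ∧ U.PerL ∧ U.HC_CM ∧ U.RealisationExistsPerL ∧ U.RealisationExistsFace ∧ ¬ U.Fact_hodgeRiemann20`,
  and `not_imp_hodgeRiemann20_of_modelAxioms_openInputs`.

## Reading (for the referees) — what this does and does NOT show

N07 is a PRINT fact (Hodge–Riemann bilinear relations in bidegree `(2,0)` on a compact Kähler surface; e.g. Voisin, *Hodge Theory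
I*, Thm 6.32), so its failure in a model is NOT an objection to PerL.  What it records is a property of THIS PACKAGE'S MODELS:
the period form of `toyUniverse₃` is positive-semidefinite and SINGULAR on `⋀² H^{1,0}` by design (toy-g2 `DESIGN.md` §1(c)/§3:
the `(01|23)` Gram block must be singular for the period relation of PerL to be non-vacuous with single-eigenvector theta sets),
and this file (like toy-g5's) exhibits an isotropic holomorphic 2-class in closed form.  Consequently NO universe constructed in
the package witnesses any hypothesis list containing `h07` non-vacuously: the generation-1 / `periodFree` universes have `tr = 0`
(pv01 `EndStateShadow.not_endState_periodFree`), the sharp witness `U♯` of pv03-g4 is period-free (`InputsWitness.h07_loadBearing`),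
and the universe of record and its CM-good restriction refute `h07` outright (§§3–4).  In particular the package holds no
absolute consistency witness for `EndStateShadow.EndState`, for `Assembly.COR_CM_endState … (hHR)` or for the `hHR` binder
of `StubTree`'s `realisationExistsPerL_of'`; and `exists_model_profile_not_hodgeRiemann20` shows that `hHR` is not recoverable
from the CONCLUSIONS of those routes (`RealisationExistsPerL ∧ RealisationExistsFace ∧ PerL ∧ HC_CM` hold while N07 fails).
A model of `ModelAxioms ∧ h07` with `h07` non-vacuous would need a trace making `η ↦ tr(η ∪ η̄)` definite on
`⋀² H^{1,0}(pms)` (a Lefschetz-type trace) while keeping M26 and the period relation — not attempted here (toy lane, toy-g5).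
-/
import Mathlib
import Summits.HodgeConjecture.HodgeCM.Model.ToyG2.ThetaPeriod
import Summits.HodgeConjecture.HodgeCM.Model.ToyG2.G4WitnessCM
import Summits.HodgeConjecture.HodgeCM.Model.ToyG2.OpenInputsAll3
import Summits.HodgeConjecture.HodgeCM.Model.Inhabited
import Summits.HodgeConjecture.HodgeCM.StubTree.Reduction
import Summits.HodgeConjecture.HodgeCM.Proofs.RealisationConstruction
import Summits.HodgeConjecture.HodgeCM.PerL34.EndStateLinks

set_option autoImplicit false

open scoped TensorProduct
open exteriorPower
open HodgeCM.Toy HodgeCM.Toy.CMPresentation NumberField.ComplexEmbedding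
open Literature.AlgebraicGeometry.Motives
open Literature.AlgebraicGeometry.Motives.HodgeStructure (conj)
open HodgeCM.Prior.Perl34File HodgeCM.Prior.Perl34File.Perl34

namespace HodgeCM.ToyG2.NoEndState3

open ThetaUiso

/-! ## §1 A CM type of a CM field of degree `≥ 4` has two distinct elements -/

/-- In a CM field `L` with `4 ≤ [L:ℚ]`, every CM type `Φ ∋ φ` contains some `ψ ≠ φ`
(else every embedding is `φ` or `φ̄`, so `[L:ℚ] = #Hom(L,ℂ) ≤ 2`). -/
theorem exists_mem_ne_of_cmType {L : CMField} (Φ : CMType L) (h4 : 4 ≤ Module.finrank ℚ L)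
    {φ : L →+* ℂ} (hφ : φ ∈ Φ.1) : ∃ ψ ∈ Φ.1, ψ ≠ φ := by
  by_contra! h
  have key : ∀ ψ : L →+* ℂ, ψ = φ ∨ ψ = conjugate φ := by
    intro ψ
    by_cases hψ : ψ ∈ Φ.1
    · exact Or.inl (h ψ hψ)
    · refine Or.inr ?_
      have hc : conjugate ψ ∈ Φ.1 := by
        by_contra hc
        exact hψ ((Φ.2 ψ).mpr hc)
      have hcφ : conjugate ψ = φ := h _ hc
      rw [← hcφ]
      exact (involutive_conjugate L ψ).symm
  have hsurj : Function.Surjective (fun b : Bool => if b then φ else conjugate φ) := by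
    intro ψ
    rcases key ψ with h1 | h1
    · exact ⟨true, by simp [h1]⟩
    · exact ⟨false, by simp [h1]⟩
  have hcard := Fintype.card_le_of_surjective _ hsurj
  rw [NumberField.Embeddings.card, Fintype.card_bool] at hcard
  have _ := hφ
  omega

/-! ## §2 The isotropic holomorphic 2-class `η = E_{k,i,τ} ∪ E_{k,i,τ'}` on `pms` of `toyUniverse₃ d t` -/

section Witness

variable (d t : ℚ) {L : CMField} (ι₁ : L →+* ℂ) {V : HermSpace3 L ι₁} (Γ : Level V)
  (k : Fin (nQ L ι₁)) (i : Fin 4)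

/-- the class `η_{k,i;τ,τ'} := E_{k,i,τ} ∪ E_{k,i,τ'} ∈ H²(pms, ℂ)` of `toyUniverse₃ d t` -/
noncomputable def eta (τ τ' : FK L →+* ℂ) :
    (toyUniverse₃ d t).CohC ((toyUniverse₃ d t).pms L ι₁ V Γ) 2 :=
  (toyUniverse₃ d t).cup2C ((toyUniverse₃ d t).pms L ι₁ V Γ) 1 (eCls ι₁ d t k i τ) (eCls ι₁ d t k i τ')

/-- the constant slot pattern `(i,i,i,i)` is off the admissible patterns of `trC_quadC_eCls_eq_zero₃`:
no two distinct slots are each hit twice, and some slot is missed -/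
private lemma constPattern_off (i : Fin 4) :
    (∀ a b : Fin 4, a ≠ b →
      (Finset.univ.filter fun c : Fin 4 => (fun _ : Fin 4 => i) c = a).card < 2 ∨
        (Finset.univ.filter fun c : Fin 4 => (fun _ : Fin 4 => i) c = b).card < 2) ∧
    ∃ c₀ : Fin 4, ∀ c : Fin 4, (fun _ : Fin 4 => i) c ≠ c₀ := by
  fin_cases i <;> decide

/-- **`tr(η ∪ η̄) = 0`**: `conj η = E_{k,i,τ̄} ∪ E_{k,i,τ̄'}`, so `η ∪ η̄ = quad(E_τ, E_τ', E_τ̄, E_τ̄')` has the constant slot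
pattern `(i,i,i,i)`, on which the trace of `toyUniverse₃` vanishes (`trC_quadC_eCls_eq_zero₃`). -/
theorem trC_eta_conj_eq_zero (τ τ' : FK L →+* ℂ) :
    (toyUniverse₃ d t).trC ((toyUniverse₃ d t).pms L ι₁ V Γ) 4
      ((toyUniverse₃ d t).cup2C ((toyUniverse₃ d t).pms L ι₁ V Γ) 2
        (eta d t ι₁ Γ k i τ τ') (conj (eta d t ι₁ Γ k i τ τ'))) = 0 := by
  obtain ⟨hE, hT⟩ := constPattern_off i
  have h := trC_quadC_eCls_eq_zero₃ d t ι₁ Γ k (fun _ : Fin 4 => i) ![τ, τ', conjugate τ, conjugate τ'] hE hT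
  simp only [v4_0, v4_1, v4_2, v4_3] at h
  -- `conj η = E_{k,i,τ̄} ∪ E_{k,i,τ̄'}`
  have hc : conj (eta d t ι₁ Γ k i τ τ') = eta d t ι₁ Γ k i (conjugate τ) (conjugate τ') := by
    show HodgeStructure.conj ((toyUniverse₃ d t).cup2C ((toyUniverse₃ d t).pms L ι₁ V Γ) 1
        (eCls ι₁ d t k i τ) (eCls ι₁ d t k i τ')) = _
    rw [Universe.conj_cup2C]
    show (toyUniverse₃ d t).cup2C ((toyUniverse₃ d t).pms L ι₁ V Γ) 1
        (HodgeStructure.conj (V := ↥(⋀[ℚ]^1 (PO ι₁ d t).L)) (eCls ι₁ d t k i τ))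
        (HodgeStructure.conj (V := ↥(⋀[ℚ]^1 (PO ι₁ d t).L)) (eCls ι₁ d t k i τ')) = _
    rw [conj_eCls, conj_eCls]
    rfl
  rw [hc]
  exact h

/-- **`η ∈ F²H²(pms)`** when both indices are holomorphic (`τ|_L, τ'|_L ∈ Θ_{k,i}`): `E_{k,i,τ} ∈ H^{1,0}` and M4. -/
theorem eta_mem_F2 {τ τ' : FK L →+* ℂ} (hτ : τ.comp (eK L : L →+* FK L) ∈ (ΘOf L ι₁ k i).1)
    (hτ' : τ'.comp (eK L : L →+* FK L) ∈ (ΘOf L ι₁ k i).1) :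
    eta d t ι₁ Γ k i τ τ' ∈ ((toyUniverse₃ d t).hodge ((toyUniverse₃ d t).pms L ι₁ V Γ) 2).F 2 :=
  Universe.cup2C_mem_F2 (toyUniverse₃_modelAxioms_all d t) _ (eCls_mem_H10₃ d t ι₁ Γ k i hτ)
    (eCls_mem_H10₃ d t ι₁ Γ k i hτ')

/-- **`η ≠ 0`** for `τ ≠ τ'` (wedge of two distinct basis eigenvectors). -/
theorem eta_ne_zero {τ τ' : FK L →+* ℂ} (hne : τ ≠ τ') : eta d t ι₁ Γ k i τ τ' ≠ 0 :=
  cup_eCls_ne_zero₃ d t ι₁ Γ (Or.inr (Or.inr hne))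

end Witness

section Refutation

variable (d t : ℚ) {L : CMField} (ι₁ : L →+* ℂ)

/-- **The witness, for any CM field of degree `≥ 4`**: an explicit nonzero `η ∈ F²H²(pms L ι₁ V Γ)` with `tr(η ∪ η̄) = 0`. -/
theorem exists_F2_ne_zero_tr_eq_zero {V : HermSpace3 L ι₁} (Γ : Level V) (k : Fin (nQ L ι₁))
    (h4 : 4 ≤ Module.finrank ℚ L) :
    ∃ η : (toyUniverse₃ d t).CohC ((toyUniverse₃ d t).pms L ι₁ V Γ) 2,
      η ∈ ((toyUniverse₃ d t).hodge ((toyUniverse₃ d t).pms L ι₁ V Γ) 2).F 2 ∧ η ≠ 0 ∧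
      (toyUniverse₃ d t).trC ((toyUniverse₃ d t).pms L ι₁ V Γ) 4
        ((toyUniverse₃ d t).cup2C ((toyUniverse₃ d t).pms L ι₁ V Γ) 2 η (conj η)) = 0 := by
  obtain ⟨ψ, hψ, hne⟩ := exists_mem_ne_of_cmType (ΘOf L ι₁ k 0) h4 (mem_ΘOf L ι₁ k 0)
  have hτ : (embOf L ι₁).comp (eK L : L →+* FK L) ∈ (ΘOf L ι₁ k 0).1 := by
    rw [embOf_comp]; exact mem_ΘOf L ι₁ k 0
  have hτ' : (embOf L ψ).comp (eK L : L →+* FK L) ∈ (ΘOf L ι₁ k 0).1 := by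
    rw [embOf_comp]; exact hψ
  have hne' : embOf L ι₁ ≠ embOf L ψ := by
    intro h
    apply hne
    rw [← embOf_comp L ψ, ← h, embOf_comp]
  exact ⟨eta d t ι₁ Γ k 0 (embOf L ι₁) (embOf L ψ), eta_mem_F2 d t ι₁ Γ k 0 hτ hτ', eta_ne_zero d t ι₁ Γ k 0 hne',
    trC_eta_conj_eq_zero d t ι₁ Γ k 0 _ _⟩

/-- **N07 fails in `toyUniverse₃ d t` as soon as one block over a CM field of degree `≥ 4` is available.** -/
theorem not_hodgeRiemann20_of_finrank (h4 : 4 ≤ Module.finrank ℚ L) (V : HermSpace3 L ι₁) (Γ : Level V)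
    (k : Fin (nQ L ι₁)) : ¬ (toyUniverse₃ d t).Fact_hodgeRiemann20 := by
  intro hHR
  obtain ⟨η, hF, hne, htr⟩ := exists_F2_ne_zero_tr_eq_zero d t ι₁ Γ k h4
  exact hHR _ ((toyUniverse₃_modelAxioms_all d t).pms_dim L ι₁ V Γ) η hF hne htr

/-- The same in the **CM-good universe** `toyUniverseCM d t = (toyUniverse₃ d t)|_{IsCM}` (every `pms` is an object of it;
cohomology, Hodge filtration, cup product and trace are those of `toyUniverse₃`, by `rfl`). -/
theorem not_hodgeRiemann20_of_finrank_CM (h4 : 4 ≤ Module.finrank ℚ L) (V : HermSpace3 L ι₁) (Γ : Level V)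
    (k : Fin (nQ L ι₁)) : ¬ (toyUniverseCM d t).Fact_hodgeRiemann20 := by
  intro hHR
  obtain ⟨η, hF, hne, htr⟩ := exists_F2_ne_zero_tr_eq_zero d t ι₁ Γ k h4
  exact hHR ((toyUniverseCM d t).pms L ι₁ V Γ) ((toyUniverse₃_modelAxioms_all d t).pms_dim L ι₁ V Γ) η hF hne htr

end Refutation

/-! ## §3 The universe of record: `L = ℚ(ζ₇)` -/

/-- a complex embedding of `ℚ(ζ₇)` (any) -/
noncomputable def ι₇ : (cyclo7 : CMField) →+* ℂ := Classical.arbitrary _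

/-- Landherr's hermitian space over `(ℚ(ζ₇), ι₇)` (signature `(2,1)` at `ι₇`), from `StubTree.landherr_exists` -/
noncomputable def V₇ : HermSpace3 cyclo7 ι₇ := Classical.choice (StubTree.landherr_exists cyclo7 ι₇)

/-- the block of the constant admissible quadruple `(Φ, Φ, Φ, Φ)`, `Φ ∋ ι₇` -/
noncomputable def k₇ : Fin (nQ cyclo7 ι₇) := eQ cyclo7 ι₇ (qAt cyclo7 ι₇)

/-- (Ported verbatim from the HodgeCMPerL package; no docstring in the source.) -/
lemma four_le_finrank_cyclo7 : 4 ≤ Module.finrank ℚ cyclo7 := by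
  rw [cyclo7_finrank]; norm_num

/-- **The Hodge–Riemann `(2,0)` fact N07 is FALSE in the universe of record `toyUniverse₃ d t`, for every `d t`** — single-block
witness on the surface `pms ℚ(ζ₇) ι₇ V₇ (Level.three V₇)`, block `k₇ = [qAt]`.  (Headline of record: toy-g5's
`HodgeCM.ToyG2.not_toyUniverse₃_hodgeRiemann20`, mixed-block witness; this is a second, import-independent proof.) -/
theorem toyUniverse₃_not_hodgeRiemann20 (d t : ℚ) : ¬ (toyUniverse₃ d t).Fact_hodgeRiemann20 :=
  not_hodgeRiemann20_of_finrank d t ι₇ four_le_finrank_cyclo7 V₇ (Level.three V₇) k₇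

/-- … and in the CM-good universe `toyUniverseCM d t`. -/
theorem toyUniverseCM_not_hodgeRiemann20 (d t : ℚ) : ¬ (toyUniverseCM d t).Fact_hodgeRiemann20 :=
  not_hodgeRiemann20_of_finrank_CM d t ι₇ four_le_finrank_cyclo7 V₇ (Level.three V₇) k₇

/-- N07 in the `PerL34` naming. -/
theorem toyUniverse₃_not_N07 (d t : ℚ) : ¬ PerL34.N07_hodgeRiemann20 (toyUniverse₃ d t) :=
  toyUniverse₃_not_hodgeRiemann20 d t

/-- (Ported verbatim from the HodgeCMPerL package; no docstring in the source.) -/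
theorem toyUniverseCM_not_N07 (d t : ℚ) : ¬ PerL34.N07_hodgeRiemann20 (toyUniverseCM d t) :=
  toyUniverseCM_not_hodgeRiemann20 d t

/-! ## §4 No end state over the universe of record -/

/-- **No theta model over `toyUniverse₃ d t` carries the five print facts of an end state** (`EndStatePrints`, field `h07`). -/
theorem toyUniverse₃_no_endStatePrints (d t : ℚ) (T : (toyUniverse₃ d t).ThetaModel) :
    ¬ PerL34.EndStateLinks.EndStatePrints T :=
  fun E => toyUniverse₃_not_hodgeRiemann20 d t E.h07

/-- **No theta model over `toyUniverse₃ d t` carries an END STATE** of the headline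
`AssemblyRoutes.perL_of_openCharsWeilLeavesCRΔ` (`EndStateShadow.EndState T Pc`, field `h07`), whatever the pointed cores `Pc`. -/
theorem toyUniverse₃_no_endState (d t : ℚ) (T : (toyUniverse₃ d t).ThetaModel)
    (Pc : ∀ {L : CMField} {ι₁ : L →+* ℂ} (V : HermSpace3 L ι₁) (c : SeesawCtx L),
      C4a.PointedCore (T.core V c)) :
    ¬ PerL34.EndStateShadow.EndState T Pc :=
  fun E => toyUniverse₃_not_hodgeRiemann20 d t E.h07

/-- (Ported verbatim from the HodgeCMPerL package; no docstring in the source.) -/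
theorem toyUniverseCM_no_endStatePrints (d t : ℚ) (T : (toyUniverseCM d t).ThetaModel) :
    ¬ PerL34.EndStateLinks.EndStatePrints T :=
  fun E => toyUniverseCM_not_hodgeRiemann20 d t E.h07

/-- (Ported verbatim from the HodgeCMPerL package; no docstring in the source.) -/
theorem toyUniverseCM_no_endState (d t : ℚ) (T : (toyUniverseCM d t).ThetaModel)
    (Pc : ∀ {L : CMField} {ι₁ : L →+* ℂ} (V : HermSpace3 L ι₁) (c : SeesawCtx L),
      C4a.PointedCore (T.core V c)) :
    ¬ PerL34.EndStateShadow.EndState T Pc :=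
  fun E => toyUniverseCM_not_hodgeRiemann20 d t E.h07

/-! ## §5 Transport and packaging -/

/-- **Positive transport**: a full sub-universe on a constructor-closed class of varieties inherits N07 (all data `rfl`). -/
theorem _root_.HodgeCM.Universe.restrictObj_fact_hodgeRiemann20 {U : Universe} {Q : U.Var → Prop}
    (hQ : U.SubClosed Q) (h : U.Fact_hodgeRiemann20) : (U.restrictObj Q hQ).Fact_hodgeRiemann20 :=
  fun X hX η hη hne => h X.1 hX η hη hne

/-- **Packaging (separating-model record).**  One universe with all 28 model axioms, the open inputs, both theta
realisations, `PerL` and `HC_CM`, in which N07 FAILS: `toyUniverse₃ 1 4`.  In particular the print hypothesis `hHR` of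
`StubTree`'s `realisationExistsPerL_of'` / of `Assembly.COR_CM_endState` is not recoverable from their conclusions. -/
theorem exists_model_profile_not_hodgeRiemann20 :
    ∃ U : Universe, U.ModelAxioms ∧ U.OpenInputs ∧ U.PerL ∧ U.HC_CM ∧
      U.RealisationExistsPerL ∧ U.RealisationExistsFace ∧ ¬ U.Fact_hodgeRiemann20 := by
  obtain ⟨hM, hO, ⟨hR, hRF, -, -, -, -⟩, hHC, hP, -⟩ := toyUniverse₃_profile_all 1 4 le_rfl (by norm_num)
  exact ⟨_, hM, hO, hP, hHC, hR, hRF, toyUniverse₃_not_hodgeRiemann20 1 4⟩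

/-- `ModelAxioms ∧ OpenInputs` does not imply N07. -/
theorem not_imp_hodgeRiemann20_of_modelAxioms_openInputs :
    ¬ ∀ U : Universe, U.ModelAxioms → U.OpenInputs → U.Fact_hodgeRiemann20 := by
  intro h
  obtain ⟨U, hM, hO, -, -, -, -, hHR⟩ := exists_model_profile_not_hodgeRiemann20
  exact hHR (h U hM hO)

end HodgeCM.ToyG2.NoEndState3
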